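import Mathlib

/-!
# Stub `stub_ffrNoFreeSurface` — crux `GappedShellCensus.FiveFoldRationingR`, line `Sketch`

NO FREE SURFACE from torn-freeness.  In an all-gapped-twelve, torn-free configuration `Y ⊂ ℝ³`
at scale `a` (every site has exactly twelve others within `1.02 a`, hard core `0.98 a`, no pair in
`(1.02 a, 1.26 a)`, every bond has `≥ 4` common partners), for every site `y` and every unit vector
`e` some bond partner `w` of `y` climbs `⟪w - y, e⟫ ≥ 0.18 a`.

Proof.  The partner `w` maximising `H := ⟪w - y, e⟫` over the (finite, twelve-element) shell of
`y` is the witness.  If `H < 0.18 a`, put `b := w - y`; the `≥ 4` common partners `uᵢ` of the bond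
`(y, w)` project (lens geometry, hypothesis 1) to `qᵢ := (uᵢ - y) - αᵢ b ⊥ b` with
`|αᵢ - 1/2| ≤ 21/500`, `‖qᵢ‖² ≥ 0.69 a²`, pairwise `⟪qᵢ, qⱼ⟫ ≤ 0.41 ‖qᵢ‖ ‖qⱼ‖`, and by maximality
`⟪qᵢ, e⟫ ≤ (1 - αᵢ) H`.  With `e⊥ := e - (H / ‖b‖²) b` (so `⟪qᵢ, e⊥⟫ = ⟪qᵢ, e⟫`,
`‖e⊥‖² = 1 - H² / ‖b‖² ≥ 0.966`), the planar pigeonhole (hypothesis 2) yields an `i` with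
`‖qᵢ‖ ‖e⊥‖ / 8 < ⟪qᵢ, e⊥⟫ ≤ (1 - αᵢ) H`, impossible: the left side is `≥ 0.102 a > 0.0976 a`.
(The degenerate case `e⊥ = 0` forces `H ≤ -0.98 a` and `0 = ⟪qᵢ, e⟫ ≤ (1 - αᵢ) H < 0`.)
-/

noncomputable section

namespace Summit.AtomisticToContinuum.Crystallization.Theorems

/-- Four distinct points of a set with at least four elements, as an injective `Fin 4`-family. -/
theorem ffrNFS_four_of_le_ncard {α : Type*} {C : Set α} (h : 4 ≤ C.ncard) :
    ∃ u : Fin 4 → α, Function.Injective u ∧ ∀ i, u i ∈ C := by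
  classical
  have hCfin : C.Finite := Set.finite_of_ncard_pos (by omega)
  have hcard : Fintype.card (Fin 4) ≤ hCfin.toFinset.card := by
    rw [Fintype.card_fin, ← Set.ncard_eq_toFinset_card C hCfin]; exact h
  obtain ⟨f, hf⟩ := Function.Embedding.exists_of_card_le_finset hcard
  refine ⟨f, f.injective, fun i => ?_⟩
  have hi : f i ∈ (↑hCfin.toFinset : Set α) := hf (Set.mem_range_self i)
  rwa [Set.Finite.coe_toFinset] at hi

/-- The final numerical contradiction in the case `0 < H < 0.18 a`:
`‖qᵢ‖² ‖e⊥‖² / 64 ≥ 0.69 · (2320/2401) / 64 · a² > (0.542 · 0.18)² a² ≥ ((1 - αᵢ) H)²`. -/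
theorem ffrNFS_arith {a D H t N M L : ℝ} (ha : 0 < a) (hDlo : (a * (1 - 1 / 50)) ^ 2 ≤ D)
    (hH : H < 9 / 50 * a) (hH0 : 0 < H) (ht0 : 0 ≤ t) (ht1 : t ≤ 271 / 500)
    (hN : 69 / 100 * a ^ 2 ≤ N) (hM : 0 ≤ M) (hMD : M * D = D - H ^ 2) (hL : 0 ≤ L)
    (hL2 : L ^ 2 = 1 / 64 * (N * M)) (hlt : L < t * H) : False := by
  have ha2 : 0 < a ^ 2 := by positivity
  have hD : 0 < D := lt_of_lt_of_le (by positivity) hDlo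
  have hH2 : H ^ 2 < (9 / 50 * a) ^ 2 := sq_lt_sq' (by linarith) hH
  -- `M ≥ 2320 / 2401`
  have hM1 : 2320 / 2401 ≤ M := by
    by_contra hcon
    push Not at hcon
    have h1 : M * D < 2320 / 2401 * D := mul_lt_mul_of_pos_right hcon hD
    nlinarith
  have htH : t * H ≤ 271 / 500 * (9 / 50 * a) := by nlinarith
  have htH0 : 0 ≤ t * H := by positivity
  have hR2 : (t * H) ^ 2 ≤ (271 / 500 * (9 / 50 * a)) ^ 2 := pow_le_pow_left₀ htH0 htH 2
  have hL2' : L ^ 2 < (t * H) ^ 2 := sq_lt_sq' (by linarith) hlt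
  have hNM : 69 / 100 * a ^ 2 * (2320 / 2401) ≤ N * M := by
    nlinarith [mul_nonneg (sub_nonneg.2 hN) hM, mul_nonneg ha2.le (sub_nonneg.2 hM1)]
  nlinarith

/-- **Planar core of NO FREE SURFACE.**  Four nonzero vectors `qᵢ ⊥ b` (`‖b‖ ≥ 0.98 a`), pairwise at
angle `≥ arccos (41/100)`, with `‖qᵢ‖² ≥ 0.69 a²`, `|αᵢ - 1/2| ≤ 21/500` and
`⟪qᵢ, e⟫ ≤ (1 - αᵢ) ⟪b, e⟫` for a unit vector `e`, force `⟪b, e⟫ ≥ 0.18 a` — given the planar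
angular pigeonhole (hypothesis `hcirc`). -/
theorem ffrNFS_core
    (hcirc : ∀ (b : EuclideanSpace ℝ (Fin 3)), b ≠ 0 → ∀ e : EuclideanSpace ℝ (Fin 3), e ≠ 0 →
        inner ℝ e b = 0 → ∀ q : Fin 4 → EuclideanSpace ℝ (Fin 3),
        (∀ i, q i ≠ 0) → (∀ i, inner ℝ (q i) b = 0) →
        (∀ i j, i ≠ j → inner ℝ (q i) (q j) ≤ 41 / 100 * (‖q i‖ * ‖q j‖)) →
        ∃ i, 1 / 8 * (‖q i‖ * ‖e‖) < inner ℝ (q i) e)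
    {a : ℝ} (ha : 0 < a) {b e : EuclideanSpace ℝ (Fin 3)} (hblo : a * (1 - 1 / 50) ≤ ‖b‖)
    (he : ‖e‖ = 1) (hH : inner ℝ b e < 9 / 50 * a) {α : Fin 4 → ℝ}
    {q : Fin 4 → EuclideanSpace ℝ (Fin 3)} (hqb : ∀ i, inner ℝ (q i) b = 0)
    (hα : ∀ i, |α i - 1 / 2| ≤ 21 / 500) (hqn : ∀ i, 69 / 100 * a ^ 2 ≤ ‖q i‖ ^ 2)
    (hqq : ∀ i j, i ≠ j → inner ℝ (q i) (q j) ≤ 41 / 100 * (‖q i‖ * ‖q j‖))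
    (hmax : ∀ i, inner ℝ (q i) e ≤ (1 - α i) * inner ℝ b e) : False := by
  have ha2 : 0 < a ^ 2 := by positivity
  have hbpos : 0 < ‖b‖ := lt_of_lt_of_le (by positivity) hblo
  have hb0 : b ≠ 0 := norm_pos_iff.1 hbpos
  have hbne : ‖b‖ ≠ 0 := hbpos.ne'
  have hDlo : (a * (1 - 1 / 50)) ^ 2 ≤ ‖b‖ ^ 2 := pow_le_pow_left₀ (by positivity) hblo 2
  have hD : 0 < ‖b‖ ^ 2 := by positivity
  -- the component of `e` orthogonal to `b`
  obtain ⟨e', he'⟩ : ∃ e' : EuclideanSpace ℝ (Fin 3), e' = e - (inner ℝ b e / ‖b‖ ^ 2) • b :=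
    ⟨_, rfl⟩
  have he'b : inner ℝ e' b = 0 := by
    rw [he', inner_sub_left, real_inner_smul_left, real_inner_self_eq_norm_sq,
      real_inner_comm e b, div_mul_cancel₀ _ hD.ne', sub_self]
  have hqe' : ∀ i, inner ℝ (q i) e' = inner ℝ (q i) e := fun i => by
    rw [he', inner_sub_right, real_inner_smul_right, hqb i, mul_zero, sub_zero]
  have hMe : ‖e'‖ ^ 2 * ‖b‖ ^ 2 = ‖b‖ ^ 2 - (inner ℝ b e) ^ 2 := by
    rw [he', norm_sub_sq_real, real_inner_smul_right, norm_smul, mul_pow, Real.norm_eq_abs,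
      sq_abs, he, real_inner_comm e b]
    field_simp
    ring
  by_cases he'0 : e' = 0
  · -- degenerate case: `e` is parallel to `b`
    have hM0 : ‖e'‖ = 0 := by rw [he'0, norm_zero]
    have hHD : (inner ℝ b e) ^ 2 = ‖b‖ ^ 2 := by
      rw [hM0] at hMe
      linear_combination hMe
    have hHneg : inner ℝ b e < 0 := by
      by_contra hcon
      push Not at hcon
      have : (inner ℝ b e) ^ 2 < (9 / 50 * a) ^ 2 := sq_lt_sq' (by linarith) hH
      nlinarith
    have hq0e : inner ℝ (q 0) e = 0 := by rw [← hqe' 0, he'0, inner_zero_right]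
    have hα0 := hα 0
    rw [abs_le] at hα0
    have h0 := hmax 0
    rw [hq0e] at h0
    nlinarith [mul_pos (by linarith : 0 < 1 - α 0) (neg_pos.2 hHneg)]
  · -- main case: planar pigeonhole about `b`, looking along `e⊥`
    have hq0 : ∀ i, q i ≠ 0 := fun i h => by
      have := hqn i
      rw [h, norm_zero] at this
      nlinarith
    obtain ⟨i, hi⟩ := hcirc b hb0 e' he'0 he'b q hq0 hqb hqq
    rw [hqe' i] at hi
    have hαi := hα i
    rw [abs_le] at hαi
    have hlt : 1 / 8 * (‖q i‖ * ‖e'‖) < (1 - α i) * inner ℝ b e := lt_of_lt_of_le hi (hmax i)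
    have hL : 0 ≤ 1 / 8 * (‖q i‖ * ‖e'‖) := by positivity
    rcases le_or_gt (inner ℝ b e) 0 with hH0 | hH0
    · have : (1 - α i) * inner ℝ b e ≤ 0 :=
        mul_nonpos_of_nonneg_of_nonpos (by linarith) hH0
      linarith
    · exact ffrNFS_arith ha hDlo hH hH0 (by linarith) (by linarith) (hqn i) (sq_nonneg ‖e'‖) hMe hL
        (by ring) hlt

/-- **Stub 4 (no free surface).** In an all-gapped-twelve, torn-free configuration, for every site
`y` and unit vector `e` some bond partner `w` of `y` has `⟪w - y, e⟫ ≥ 0.18 a`: the partner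
maximising `⟪w - y, e⟫` works, by the lens geometry of the bond `(y, w)` (hypothesis 1) and the
planar angular pigeonhole (hypothesis 2) applied to four common partners of the bond. [folklore] -/
theorem stub_ffrNoFreeSurface :
    (∀ (a : ℝ), 0 < a → ∀ (y w : EuclideanSpace ℝ (Fin 3)),
      a * (1 - 1 / 50) ≤ dist y w → dist y w ≤ a * (1 + 1 / 50) →
      (∀ u : EuclideanSpace ℝ (Fin 3),
          a * (1 - 1 / 50) ≤ dist y u → dist y u ≤ a * (1 + 1 / 50) →
          a * (1 - 1 / 50) ≤ dist w u → dist w u ≤ a * (1 + 1 / 50) →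
          inner ℝ ((u - y) - (inner ℝ (u - y) (w - y) / inner ℝ (w - y) (w - y)) • (w - y)) (w - y) = 0 ∧
          |inner ℝ (u - y) (w - y) / inner ℝ (w - y) (w - y) - 1 / 2| ≤ 21 / 500 ∧
          69 / 100 * a ^ 2 ≤
            ‖(u - y) - (inner ℝ (u - y) (w - y) / inner ℝ (w - y) (w - y)) • (w - y)‖ ^ 2) ∧
      (∀ u₁ u₂ : EuclideanSpace ℝ (Fin 3),
          a * (1 - 1 / 50) ≤ dist y u₁ → dist y u₁ ≤ a * (1 + 1 / 50) →
          a * (1 - 1 / 50) ≤ dist w u₁ → dist w u₁ ≤ a * (1 + 1 / 50) →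
          a * (1 - 1 / 50) ≤ dist y u₂ → dist y u₂ ≤ a * (1 + 1 / 50) →
          a * (1 - 1 / 50) ≤ dist w u₂ → dist w u₂ ≤ a * (1 + 1 / 50) →
          a * (1 - 1 / 50) ≤ dist u₁ u₂ →
          inner ℝ ((u₁ - y) - (inner ℝ (u₁ - y) (w - y) / inner ℝ (w - y) (w - y)) • (w - y))
              ((u₂ - y) - (inner ℝ (u₂ - y) (w - y) / inner ℝ (w - y) (w - y)) • (w - y)) ≤
            41 / 100 * (‖(u₁ - y) - (inner ℝ (u₁ - y) (w - y) / inner ℝ (w - y) (w - y)) • (w - y)‖ *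
              ‖(u₂ - y) - (inner ℝ (u₂ - y) (w - y) / inner ℝ (w - y) (w - y)) • (w - y)‖))) →
    (∀ (b : EuclideanSpace ℝ (Fin 3)), b ≠ 0 → ∀ e : EuclideanSpace ℝ (Fin 3), e ≠ 0 →
        inner ℝ e b = 0 → ∀ q : Fin 4 → EuclideanSpace ℝ (Fin 3),
        (∀ i, q i ≠ 0) → (∀ i, inner ℝ (q i) b = 0) →
        (∀ i j, i ≠ j → inner ℝ (q i) (q j) ≤ 41 / 100 * (‖q i‖ * ‖q j‖)) →
        ∃ i, 1 / 8 * (‖q i‖ * ‖e‖) < inner ℝ (q i) e) →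
    ∀ (Y : Set (EuclideanSpace ℝ (Fin 3))) (a : ℝ), 0 < a →
      (∀ y ∈ Y, ({w ∈ Y | w ≠ y ∧ dist y w ≤ a * (1 + 1 / 50)}.ncard = 12 ∧
        ∀ w ∈ Y, w ≠ y → a * (1 - 1 / 50) ≤ dist y w ∧
          (dist y w ≤ a * (1 + 1 / 50) ∨ a * (63 / 50) ≤ dist y w))) →
      (∀ y ∈ Y, ∀ v ∈ Y, v ≠ y → dist y v ≤ a * (1 + 1 / 50) →
        4 ≤ {w ∈ Y | w ≠ y ∧ w ≠ v ∧ dist y w ≤ a * (1 + 1 / 50) ∧ dist v w ≤ a * (1 + 1 / 50)}.ncard) →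
      ∀ y ∈ Y, ∀ e : EuclideanSpace ℝ (Fin 3), ‖e‖ = 1 →
        ∃ w ∈ Y, w ≠ y ∧ dist y w ≤ a * (1 + 1 / 50) ∧ 9 / 50 * a ≤ inner ℝ (w - y) e := by
  intro hlens hcirc Y a ha hgap htf y hy e he
  classical
  obtain ⟨hS12, hgy⟩ := hgap y hy
  have hSfin : ({w ∈ Y | w ≠ y ∧ dist y w ≤ a * (1 + 1 / 50)} : Set _).Finite :=
    Set.finite_of_ncard_pos (by rw [hS12]; norm_num)
  have hSne : ({w ∈ Y | w ≠ y ∧ dist y w ≤ a * (1 + 1 / 50)} : Set _).Nonempty :=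
    Set.nonempty_of_ncard_ne_zero (by rw [hS12]; norm_num)
  -- the partner maximising the climb along `e`
  obtain ⟨w, ⟨hwY, hwy, hwd⟩, hmax⟩ :=
    Set.exists_max_image _ (fun v => inner ℝ (v - y) e) hSfin hSne
  have hmax' : ∀ v ∈ Y, v ≠ y → dist y v ≤ a * (1 + 1 / 50) →
      inner ℝ (v - y) e ≤ inner ℝ (w - y) e := fun v hvY hvy hvd => hmax v ⟨hvY, hvy, hvd⟩
  refine ⟨w, hwY, hwy, hwd, ?_⟩
  by_contra hH
  push Not at hH
  have hlo : a * (1 - 1 / 50) ≤ dist y w := (hgy w hwY hwy).1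
  obtain ⟨hL1, hL2⟩ := hlens a ha y w hlo hwd
  -- four distinct common partners of the bond `(y, w)`
  obtain ⟨u, huinj, huC⟩ := ffrNFS_four_of_le_ncard (htf y hy w hwY hwy hwd)
  have huY : ∀ i, u i ∈ Y := fun i => (huC i).1
  have huy : ∀ i, u i ≠ y := fun i => (huC i).2.1
  have huw : ∀ i, u i ≠ w := fun i => (huC i).2.2.1
  have hyu_hi : ∀ i, dist y (u i) ≤ a * (1 + 1 / 50) := fun i => (huC i).2.2.2.1
  have hwu_hi : ∀ i, dist w (u i) ≤ a * (1 + 1 / 50) := fun i => (huC i).2.2.2.2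
  have hyu_lo : ∀ i, a * (1 - 1 / 50) ≤ dist y (u i) := fun i => (hgy (u i) (huY i) (huy i)).1
  have hwu_lo : ∀ i, a * (1 - 1 / 50) ≤ dist w (u i) := fun i =>
    ((hgap w hwY).2 (u i) (huY i) (huw i)).1
  have huu_lo : ∀ i j, i ≠ j → a * (1 - 1 / 50) ≤ dist (u i) (u j) := fun i j hij =>
    ((hgap (u i) (huY i)).2 (u j) (huY j) (fun h => hij (huinj h).symm)).1
  -- maximality at the common partners
  have hmu : ∀ i, inner ℝ (u i - y) e ≤ inner ℝ (w - y) e := fun i =>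
    hmax' (u i) (huY i) (huy i) (hyu_hi i)
  -- the bond vector and the lens projections
  have hbn : ‖w - y‖ = dist y w := by rw [dist_comm, dist_eq_norm]
  set b : EuclideanSpace ℝ (Fin 3) := w - y with hb_def
  clear_value b
  obtain ⟨α, hαd⟩ : ∃ α : Fin 4 → ℝ, ∀ i, α i = inner ℝ (u i - y) b / inner ℝ b b :=
    ⟨_, fun _ => rfl⟩
  obtain ⟨q, hqd⟩ : ∃ q : Fin 4 → EuclideanSpace ℝ (Fin 3), ∀ i, q i = (u i - y) - α i • b :=
    ⟨_, fun _ => rfl⟩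
  have hP : ∀ i, inner ℝ (q i) b = 0 ∧ |α i - 1 / 2| ≤ 21 / 500 ∧
      69 / 100 * a ^ 2 ≤ ‖q i‖ ^ 2 := fun i => by
    rw [hqd i, hαd i]
    exact hL1 (u i) (hyu_lo i) (hyu_hi i) (hwu_lo i) (hwu_hi i)
  have hQ : ∀ i j, i ≠ j → inner ℝ (q i) (q j) ≤ 41 / 100 * (‖q i‖ * ‖q j‖) :=
    fun i j hij => by
    rw [hqd i, hqd j, hαd i, hαd j]
    exact hL2 (u i) (u j) (hyu_lo i) (hyu_hi i) (hwu_lo i) (hwu_hi i) (hyu_lo j) (hyu_hi j)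
      (hwu_lo j) (hwu_hi j) (huu_lo i j hij)
  have hmaxq : ∀ i, inner ℝ (q i) e ≤ (1 - α i) * inner ℝ b e := fun i => by
    rw [hqd i, inner_sub_left, real_inner_smul_left]
    nlinarith [hmu i]
  have hblo : a * (1 - 1 / 50) ≤ ‖b‖ := hbn ▸ hlo
  exact ffrNFS_core hcirc ha hblo he hH (fun i => (hP i).1) (fun i => (hP i).2.1)
    (fun i => (hP i).2.2) hQ hmaxq

end Summit.AtomisticToContinuum.Crystallization.Theorems

end
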